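import Summits.ResolutionOfSingularities.ResolutionOfSingularities.Theorems.FrobeniusLadderFRationalModificationCartierCertificate
import Literature.RingTheory.TightClosure.TestElementsExist
import HarnessLib

/-!
# Crux `FRationalModification` — the Cartier-divisor certificate, UNCONDITIONAL over F-finite fields (line `Sketch`, v7)

Support lemmas for crux stmt-ResolutionOfSingularities-15316
(`Summit.ResolutionOfSingularities.ResolutionOfSingularities.Theses.FrobeniusLadder.FRationalModification`,
route `FrobeniusLadder`), filed by the line lead (line `Sketch`, skeleton v7.1, lead cycle 4).

`Theorems/FrobeniusLadderFRationalModificationCartierCertificate.lean` (lead cycle 3) proved the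
consumer side of the (D+)/Cartier-hull frame of the open stub `stub_cover` CONDITIONALLY on the named
fact `Literature.RingTheory.TightClosure.HochsterHuneke1989_thm34` (test elements exist in the
F-finite case, Hochster–Huneke 1989 Thm. 3.4). That fact is now PROVED in tree
(`Literature.RingTheory.TightClosure.HochsterHuneke1989_thm34_holds`,
`Literature/RingTheory/TightClosure/TestElementsExist.lean`, lead cycle 4), so the three consumer
theorems hold unconditionally; this file records them (same statements minus the hypothesis
`hHH`). What a (D+)-construction over an F-finite (e.g. perfect) field must produce is therefore
exactly: a locally integral modification `W`, regular off an effective Cartier divisor `D`, with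
`𝒪_{W,w}/D_w` Cohen–Macaulay and F-injective at every `w ∈ Supp D` — no tight-closure side
condition remains.

* `isFRational_of_divisorCertificate_of_isRegularRing_away` — ring form (F-finite local domain `S`,
  `S/(g)` CM F-injective, `S_g` regular ⇒ `S` F-rational);
* `isFRational_stalk_of_divisorCertificate` — stalk form with `(𝒪_{X,x})_g` regular;
* `isFRational_stalk_of_cartierCertificate` — along a global effective Cartier divisor with regular
  complement (the consumer theorem);
* `rungThree_stalk_of_cartierCertificate` — the same, concluded as the crux's inline RUNG-3 clause:
  over an F-finite field the Cartier certificate feeds the first branch of `stub_cover` directly.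
-/

-- single-problem summit: the doubled namespace component `ResolutionOfSingularities` is forced
set_option linter.dupNamespace false

noncomputable section

open CategoryTheory AlgebraicGeometry TopologicalSpace
open IsLocalRing Literature.RingTheory.TightClosure Literature.AlgebraicGeometry.Resolution
open Summit.ResolutionOfSingularities.ResolutionOfSingularities.Theorems.FRationalModification

namespace Summit.ResolutionOfSingularities.ResolutionOfSingularities.Theorems.FRationalModification.CartierCertificateHolds

/-- **Divisor certificate over an F-finite stalk, Fedder–Watanabe shape — unconditional.** A
Noetherian local F-finite domain `S` of characteristic `p` with `g ∈ 𝔪_S`, `g ≠ 0`, such that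
`S/(g)` is Cohen–Macaulay and F-injective (every system of parameters of `S/(g)` a weakly regular
sequence generating a Frobenius-closed ideal) and `S_g` regular, is F-rational
(`CartierCertificate.isFRational_of_divisorCertificate_of_isRegularRing_away` with the test-element
theorem `HochsterHuneke1989_thm34_holds` plugged in). [cite: FedderWatanabe1989, Prop. 2.13;
HochsterHuneke1989, Thm. 3.4] -/
theorem isFRational_of_divisorCertificate_of_isRegularRing_away
    (p : ℕ) [Fact p.Prime] {S : Type} [CommRing S] [IsLocalRing S] [IsNoetherianRing S] [IsDomain S]
    [CharP S p] (hF : IsFFinite p 1 S) {g : S} (hgm : g ∈ maximalIdeal S) (hg0 : g ≠ 0)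
    (hreg : IsRegularRing (Localization.Away g))
    (hD : ∀ d : ℕ, ringKrullDim (S ⧸ Ideal.span {g}) = d → ∀ t : Fin d → S ⧸ Ideal.span {g},
      (Ideal.span (Set.range t)).radical.IsMaximal →
        RingTheory.Sequence.IsWeaklyRegular (S ⧸ Ideal.span {g}) (List.ofFn t) ∧
        ∀ y : S ⧸ Ideal.span {g}, (∃ e : ℕ, y ^ p ^ e ∈
          Ideal.span ((fun z : S ⧸ Ideal.span {g} => z ^ p ^ e) ''
            (Ideal.span (Set.range t) : Set (S ⧸ Ideal.span {g})))) →
          y ∈ Ideal.span (Set.range t)) :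
    IsFRational S p :=
  CartierCertificate.isFRational_of_divisorCertificate_of_isRegularRing_away
    HochsterHuneke1989_thm34_holds p hF hgm hg0 hreg hD

/-- **Divisor certificate at a stalk of a `k`-scheme, `k` F-finite — unconditional**: for
`f : X → Spec k` locally of finite type, `x ∈ X` with `𝒪_{X,x}` a domain, and `g ∈ 𝔪_x`, `g ≠ 0`,
such that `𝒪_{X,x}/(g)` is Cohen–Macaulay and F-injective and `(𝒪_{X,x})_g` is a regular ring, the
stalk `𝒪_{X,x}` is F-rational. [cite: FedderWatanabe1989, Prop. 2.13; HochsterHuneke1989, Thm. 3.4] -/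
theorem isFRational_stalk_of_divisorCertificate {p : ℕ}
    [Fact p.Prime] {k : Type} [Field k] [CharP k p] (hk : IsFFinite p 1 k) {X : Scheme.{0}}
    (f : X ⟶ Spec (.of k)) [LocallyOfFiniteType f] (x : X) [IsDomain (X.presheaf.stalk x)]
    [CharP (X.presheaf.stalk x) p] {g : X.presheaf.stalk x}
    (hgm : g ∈ maximalIdeal (X.presheaf.stalk x)) (hg0 : g ≠ 0)
    (hreg : IsRegularRing (Localization.Away g))
    (hD : ∀ d : ℕ, ringKrullDim (X.presheaf.stalk x ⧸ Ideal.span {g}) = d →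
      ∀ t : Fin d → X.presheaf.stalk x ⧸ Ideal.span {g},
        (Ideal.span (Set.range t)).radical.IsMaximal →
          RingTheory.Sequence.IsWeaklyRegular (X.presheaf.stalk x ⧸ Ideal.span {g}) (List.ofFn t) ∧
          ∀ y : X.presheaf.stalk x ⧸ Ideal.span {g}, (∃ e : ℕ, y ^ p ^ e ∈
            Ideal.span ((fun z : X.presheaf.stalk x ⧸ Ideal.span {g} => z ^ p ^ e) ''
              (Ideal.span (Set.range t) : Set (X.presheaf.stalk x ⧸ Ideal.span {g})))) →
            y ∈ Ideal.span (Set.range t)) :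
    IsFRational (X.presheaf.stalk x) p :=
  CartierCertificate.isFRational_stalk_of_divisorCertificate HochsterHuneke1989_thm34_holds hk f x
    hgm hg0 hreg hD

/-- **F-rationality along a Cohen–Macaulay F-injective effective Cartier divisor with regular
complement — unconditional over F-finite fields.** `f : X → Spec k` locally of finite type, `k`
F-finite of characteristic `p`, `D ⊂ X` an effective Cartier divisor (`IsEffectiveCartier`),
`x ∈ Supp D` with `𝒪_{X,x}` a domain, `X` regular at every generization of `x` outside `Supp D`, and
`𝒪_{X,x}/D_x` Cohen–Macaulay and F-injective (inline s.o.p. language); then `𝒪_{X,x}` is F-rational.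
This is `CartierCertificate.isFRational_stalk_of_cartierCertificate` (Fedder–Watanabe 1989 Prop. 2.13
along a divisor) with its only named-fact hypothesis discharged by `HochsterHuneke1989_thm34_holds`:
the consumer of the (D+)/Cartier-hull frame of `stub_cover` is now unconditional.
[cite: FedderWatanabe1989, Prop. 2.13; HochsterHuneke1989, Thm. 3.4] -/
theorem isFRational_stalk_of_cartierCertificate {p : ℕ}
    [Fact p.Prime] {k : Type} [Field k] [CharP k p] (hk : IsFFinite p 1 k) {X : Scheme.{0}}
    (f : X ⟶ Spec (.of k)) [LocallyOfFiniteType f] {D : X.IdealSheafData}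
    (hD : IsEffectiveCartier D) {x : X} (hx : x ∈ D.support) [IsDomain (X.presheaf.stalk x)]
    [CharP (X.presheaf.stalk x) p]
    (hreg : ∀ (x' : X), x' ⤳ x → x' ∉ D.support → IsRegularLocalRing (X.presheaf.stalk x'))
    (hcert : ∀ d : ℕ, ringKrullDim (X.presheaf.stalk x ⧸ stalkIdeal D x) = d →
      ∀ t : Fin d → X.presheaf.stalk x ⧸ stalkIdeal D x,
        (Ideal.span (Set.range t)).radical.IsMaximal →
          RingTheory.Sequence.IsWeaklyRegular (X.presheaf.stalk x ⧸ stalkIdeal D x) (List.ofFn t) ∧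
          ∀ y : X.presheaf.stalk x ⧸ stalkIdeal D x, (∃ e : ℕ, y ^ p ^ e ∈
            Ideal.span ((fun z : X.presheaf.stalk x ⧸ stalkIdeal D x => z ^ p ^ e) ''
              (Ideal.span (Set.range t) : Set (X.presheaf.stalk x ⧸ stalkIdeal D x)))) →
            y ∈ Ideal.span (Set.range t)) :
    IsFRational (X.presheaf.stalk x) p :=
  CartierCertificate.isFRational_stalk_of_cartierCertificate HochsterHuneke1989_thm34_holds hk f hD hx
    hreg hcert

/-- **The Cartier certificate feeds the RUNG-3 branch of `stub_cover` directly (F-finite field).** Same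
hypotheses as `isFRational_stalk_of_cartierCertificate`; conclusion: the crux's inline rung-3 clause at
`𝒪_{X,x}` (domain; every ideal generated by a system of parameters tightly closed, "all `e`, any
`c ≠ 0`" form — `isFRational_iff_of_isDomain`). So over an F-finite ground field a (D+)-construction
certifies its points in the FIRST branch of `stub_cover` and the test-element clause of the second
branch is never needed. [cite: FedderWatanabe1989, Prop. 2.13; HochsterHuneke1989, Thm. 3.4] -/
theorem rungThree_stalk_of_cartierCertificate {p : ℕ}
    [Fact p.Prime] {k : Type} [Field k] [CharP k p] (hk : IsFFinite p 1 k) {X : Scheme.{0}}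
    (f : X ⟶ Spec (.of k)) [LocallyOfFiniteType f] {D : X.IdealSheafData}
    (hD : IsEffectiveCartier D) {x : X} (hx : x ∈ D.support) [IsDomain (X.presheaf.stalk x)]
    [CharP (X.presheaf.stalk x) p]
    (hreg : ∀ (x' : X), x' ⤳ x → x' ∉ D.support → IsRegularLocalRing (X.presheaf.stalk x'))
    (hcert : ∀ d : ℕ, ringKrullDim (X.presheaf.stalk x ⧸ stalkIdeal D x) = d →
      ∀ t : Fin d → X.presheaf.stalk x ⧸ stalkIdeal D x,
        (Ideal.span (Set.range t)).radical.IsMaximal →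
          RingTheory.Sequence.IsWeaklyRegular (X.presheaf.stalk x ⧸ stalkIdeal D x) (List.ofFn t) ∧
          ∀ y : X.presheaf.stalk x ⧸ stalkIdeal D x, (∃ e : ℕ, y ^ p ^ e ∈
            Ideal.span ((fun z : X.presheaf.stalk x ⧸ stalkIdeal D x => z ^ p ^ e) ''
              (Ideal.span (Set.range t) : Set (X.presheaf.stalk x ⧸ stalkIdeal D x)))) →
            y ∈ Ideal.span (Set.range t)) :
    IsDomain (X.presheaf.stalk x) ∧
      ∀ d : ℕ, ringKrullDim (X.presheaf.stalk x) = d → ∀ s : Fin d → X.presheaf.stalk x,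
        (Ideal.span (Set.range s)).radical.IsMaximal → ∀ y c : X.presheaf.stalk x, c ≠ 0 →
          (∀ e : ℕ, c * y ^ p ^ e ∈
            Ideal.span ((fun z : X.presheaf.stalk x => z ^ p ^ e) ''
              (Ideal.span (Set.range s) : Set (X.presheaf.stalk x)))) →
          y ∈ Ideal.span (Set.range s) :=
  ⟨inferInstance, (isFRational_iff_of_isDomain p).mp
    (isFRational_stalk_of_cartierCertificate hk f hD hx hreg hcert)⟩

end Summit.ResolutionOfSingularities.ResolutionOfSingularities.Theorems.FRationalModification.CartierCertificateHolds

end
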